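import Summits.KontsevichZagierPeriods.Zeta5Search.WedgeDictionaryDescent22Mirror
import Summits.KontsevichZagierPeriods.Zeta5Search.WedgeDictionaryGaugeStep
import HarnessLib

/-!
# ζ(5) search, D2 lane (gen-1 g11) — the `P̂`-part transported along Brown–Zudilin's whole group `G`: every generator
`g ∈ {i₁, p₀₁, p₁₂, h, h′}` pulls the conclusion of the `P̂`-node back from `g·a` to `a` (kernel-checked covariance)

HONEST FRAMING: systematic search; no irrationality claim unless certified.  Nothing in this file bears on irrationality; it
is bookkeeping between identities of special functions, conditional on the cited facts named in the hypotheses.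

WHAT.  `WedgeDictionaryDescent22Closed` reduces the `P̂`-third of `explicitPQ` to three cited facts on the residue range
`p₄ + q₄ ≤ p₃` (node `phatPartResidueLD`), and `WedgeDictionaryDescent22Mirror` transports it to the mirror range by `i₁`.
Brown–Zudilin's group `G` (arXiv:2210.03391v3, Sect. 7; generators `i₁, p₀₁, p₁₂, h, h′`, tree `GeneralFamily.gen*`) acts on
the dual parameters `b(a)` by SLOT TRANSPOSITIONS — `p₀₁ ↦ (3 4)`, `p₁₂ ↦ (3 5)`, `h ↦ (3 6)`, `h′ ↦ (4 6)` (and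
`i₁ ↦ (1 4)(2 3)(5 7)`) — and multiplies the integral by the factorial gauge `∏_{i∈F} h_i(g a)!/∏_{i∈F} h_i(a)!` (the cited (27),
`invariance_of_converges'`).  This file PROVES that every ingredient of the node's conclusion is covariant with the same gauge:

* `bOfA_genP01/P12/H/Hp : b(g a) = σ_g • b(a)` (identities of linear forms);
* `rhoOf_eq_rhoH`: gen-1's closed scalar `ρ` written in the 28 forms `h_i` of (26) — the seven slots `b_j` and the
  twenty-one pair forms `b₀ − b_j − b_k` ARE the 28 forms; hence, with the tree's `CellularGroup.hForm_gen*` (each generator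
  permutes the 28 forms), the FORMAL identities `rho_gauge_* : ρ(g a) · Π_F(a) = ρ(a) · Π_F(g a)` (`Π_F = ∏_{i∈F} h_i!`);
* `quadM3_permLower`: the minor `M₃` is `S₇`-invariant, so by the tree's THEOREM `qPart_holds` (`Q = ρ·M₃` on the region)
  `Q` carries the same gauge — no binomial-sum identity for (17) is needed;
* the generic pull-back **`phatConclusion_transport`**: if `b(g a) = σ•b(a)` and `ρ` has the gauge, then for convergent `a`,
  `g a` in the region, (27) at `g` and the conclusion of the node at `(g a, m+1)` give the conclusion at `(a, σ(m)+1)`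
  (the rational `P` is rescaled by the gauge); instances **`phatConclusion_genI1/genP01/genP12/genH/genHp`**, each from
  `invariance_of_converges'` at that generator only.

So the set of parameters at which the `P̂`-part is established is closed under the generators along convergent points of
the region; endpoints are discharged by `phatPartResidueLD` (`phatConclusion_of_LD`) — itself reduced to `descent22`,
`vwp_eq_integral_of_pos`, `baileyTransformClosed` in `WedgeDictionaryDescent22Closed` (mirror endpoints by `phatConclusion_of_LDMirror`).  Worked example at the end.

COVERAGE (exact census `HOME/code/gen1/g11/group_census2.py`, seconds): universe = `wedgeDictionary`'s domain (convergent,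
region, `d ≥ 0`, a partner exists).  The LD box `2b_i ≤ b₀` is `S₇`-invariant, so points off it stay uncovered on this line.
Inside the LD box: box `{1..4}⁸` 16742 points — residue range 8856 (52.9 %), with the mirror 12686 (75.8 %), with `G`-orbit
transport through convergent region points **16465 (98.3 %)**; `{0..3}⁸`: 4968 — 2758 / 4011 / **4881 (98.2 %)**; `{1..3}⁸`:
2389 — 1351 / 1858 / **2355 (98.6 %)**.  Residual examples: `b = (7;3,3,3,3,3,3,3)` (`d = 0`, the clause-2 obstruction of
`WedgeDictionaryDescent22Closed`), `b = (4;1,1,1,1,1,1,1)` (residue defect `≥ 1` on the whole convergent orbit part).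
What this is NOT: no proof of (22), (27), the Bailey invariance or `qPart`'s inputs beyond what the tree proves; no irrationality.
-/

noncomputable section

open Finset

namespace Summit.KontsevichZagierPeriods.Zeta5Search.WedgeDictionary

open Summit.KontsevichZagierPeriods.Zeta5Search.DualSeries
open Literature.NumberTheory.Irrationality.BrownZudilin2022
open Literature.NumberTheory.Irrationality.Zudilin2002 (vwp_eq_integral_of_pos)
open Literature.NumberTheory.Irrationality.Zudilin2004 (baileyTransformClosed)
open Literature.NumberTheory.Transcendental (zetaValue)
open Summit.KontsevichZagierPeriods.Zeta5Search.SymmetricGauge (permLower permLower_apply_succ permLower_zero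
  permLower_apply_of_not coeffU_permLower coeffV_permLower coeffW_permLower pfData_permLower shift_permLower dOf_permLower
  sum_range7_permLower)
open Summit.KontsevichZagierPeriods.Zeta5Search.CasoratianValuation (shift)
open Summit.KontsevichZagierPeriods.Zeta5Search.CellularGroup (hForm_genI1 hForm_genP01 hForm_genP12 hForm_genH hForm_genHp)
open Summit.KontsevichZagierPeriods.Zeta5Search.WedgeDictionary.OmegaRec (qPart_holds)

/-! ## 1. The conclusion of the `P̂`-nodes, the factorial gauge, and `ρ` in the 28 forms -/

/-- The common CONCLUSION of `phatPartResidueLD` / `phatPartResidueLDMirror` at `(a, j)`: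
`∃ P ∈ ℚ, I(a) = Q(a)(2ζ(5)+4ζ(3)ζ(2)) − 4ρ(a)(U(b)V(b+e_j) − U(b+e_j)V(b))ζ(2) − 2P`, `b = b(a)`. -/
def PhatConclusion (a : Fin 8 → ℤ) (j : ℕ) : Prop :=
  ∃ P : ℚ, cellularIntegral a =
      (QOf a : ℝ) * (2 * zetaValue 5 + 4 * zetaValue 3 * zetaValue 2) -
        4 * ((rhoOf a * (coeffU (bOfA a) * coeffV (Function.update (bOfA a) j (bOfA a j + 1)) -
              coeffU (Function.update (bOfA a) j (bOfA a j + 1)) * coeffV (bOfA a)) : ℚ) : ℝ) * zetaValue 2 -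
        2 * (P : ℝ)

/-- The node `phatPartResidueLD` discharges `PhatConclusion` under its ten hypotheses (unfolding). -/
theorem phatConclusion_of_LD (h : phatPartResidueLD) {a : Fin 8 → ℤ} {j : ℕ} (hj : j ∈ Icc 1 7) (hconv : Converges a)
    (hreg : ∀ i ∈ Icc 1 7, 0 ≤ bOfA a i ∧ 2 * bOfA a i ≤ bOfA a 0 + 1) (hd : 0 ≤ dOf (bOfA a))
    (hj' : 2 * (bOfA a j + 1) ≤ bOfA a 0 + 1) (hbox : ∀ i ∈ Icc 1 7, 2 * bOfA a i ≤ bOfA a 0)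
    (hp : ∀ i, 0 ≤ pOf a i) (hq : ∀ i, 0 ≤ qOf a i) (hres : pOf a 4 + qOf a 3 ≤ pOf a 3)
    (hcl : bOfA a 0 - bOfA a 1 - bOfA a 2 ≤ dOf (bOfA a) + max 0 (max (bOfA a 7 - bOfA a 1) (bOfA a 7 - bOfA a 2))) :
    PhatConclusion a j :=
  h a j hj hconv hreg hd hj' hbox hp hq hres hcl

/-- `Π_F(a) = ∏_{i∈F} h_i(a)!` as a rational number (the gauge of (27)). -/
def prodFQ (a : Fin 8 → ℤ) : ℚ := (Fset.map fun i => ((hForm a i).toNat.factorial : ℚ)).prod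

/-- `Π_F(a) > 0`. -/
theorem prodFQ_pos (a : Fin 8 → ℤ) : 0 < prodFQ a := by
  simp only [prodFQ, Fset, List.map, List.prod_cons, List.prod_nil]
  positivity

/-- The real product in `normalisedIntegral'` is `Π_F(a)`. -/
theorem prodFQ_cast (a : Fin 8 → ℤ) :
    (Fset.map fun i => ((hForm a i).toNat.factorial : ℝ)).prod = ((prodFQ a : ℚ) : ℝ) := by
  simp only [prodFQ, Fset, List.map, List.prod_cons, List.prod_nil]
  push_cast
  ring

/-- `(27)` in the form `I(a)/Π_F(a)`. -/
theorem normalisedIntegral'_eq (a : Fin 8 → ℤ) : normalisedIntegral' a = cellularIntegral a / ((prodFQ a : ℚ) : ℝ) := by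
  unfold normalisedIntegral'
  rw [prodFQ_cast]

/-- gen-1's closed scalar written in the 28 forms (26): numerator over the pair forms of `E`
(`h₁,h₉,h₁₀,h₁₁,h₃,h₁₆,h₁₈,h₁₄,h₅,h₂₃,h₂₀,h₂₈,h₆,h₂₇,h₇ = b₀−b_j−b_k`, `(j,k) ∈ E`), denominator over the slots
`b₁,b₄,b₅,b₆,b₇ = h₁₅,h₁₂,h₁₃,h₁₇,h₂₄` and `d!`. -/
def rhoH (a : Fin 8 → ℤ) : ℚ :=
  (-1 : ℚ) ^ (∑ j ∈ range 7, bOfA a (j + 1)).toNat *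
      (([1, 9, 10, 11, 3, 16, 18, 14, 5, 23, 20, 28, 6, 27, 7] : List ℕ).map
        fun i => ((hForm a i).toNat.factorial : ℚ)).prod /
    (4 * (([15, 12, 13, 17, 24] : List ℕ).map fun i => ((hForm a i).toNat.factorial : ℚ)).prod *
      ((dOf (bOfA a)).toNat.factorial : ℚ))

/-- **`ρ(a) = rhoH a`**: the 15 pair forms and 5 slots of `ρ` are forms of (26). -/
theorem rhoOf_eq_rhoH (a : Fin 8 → ℤ) : rhoOf a = rhoH a := by
  have e12 : bOfA a 0 - bOfA a 1 - bOfA a 2 = hForm a 1 := by simp [bOfA, hForm, hList]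
  have e13 : bOfA a 0 - bOfA a 1 - bOfA a 3 = hForm a 9 := by simp [bOfA, hForm, hList]; ring
  have e14 : bOfA a 0 - bOfA a 1 - bOfA a 4 = hForm a 10 := by simp [bOfA, hForm, hList]; ring
  have e15 : bOfA a 0 - bOfA a 1 - bOfA a 5 = hForm a 11 := by simp [bOfA, hForm, hList]; ring
  have e23 : bOfA a 0 - bOfA a 2 - bOfA a 3 = hForm a 3 := by simp [bOfA, hForm, hList]; ring
  have e24 : bOfA a 0 - bOfA a 2 - bOfA a 4 = hForm a 16 := by simp [bOfA, hForm, hList]; ring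
  have e25 : bOfA a 0 - bOfA a 2 - bOfA a 5 = hForm a 18 := by simp [bOfA, hForm, hList]; ring
  have e26 : bOfA a 0 - bOfA a 2 - bOfA a 6 = hForm a 14 := by simp [bOfA, hForm, hList]; ring
  have e34 : bOfA a 0 - bOfA a 3 - bOfA a 4 = hForm a 5 := by simp [bOfA, hForm, hList]
  have e36 : bOfA a 0 - bOfA a 3 - bOfA a 6 = hForm a 23 := by simp [bOfA, hForm, hList]; ring
  have e37 : bOfA a 0 - bOfA a 3 - bOfA a 7 = hForm a 20 := by simp [bOfA, hForm, hList]; ring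
  have e47 : bOfA a 0 - bOfA a 4 - bOfA a 7 = hForm a 28 := by simp [bOfA, hForm, hList]; ring
  have e56 : bOfA a 0 - bOfA a 5 - bOfA a 6 = hForm a 6 := by simp [bOfA, hForm, hList]
  have e57 : bOfA a 0 - bOfA a 5 - bOfA a 7 = hForm a 27 := by simp [bOfA, hForm, hList]; ring
  have e67 : bOfA a 0 - bOfA a 6 - bOfA a 7 = hForm a 7 := by simp [bOfA, hForm, hList]; ring
  have s1 : bOfA a 1 = hForm a 15 := by simp [bOfA, hForm, hList]; ring
  have s4 : bOfA a 4 = hForm a 12 := by simp [bOfA, hForm, hList]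
  have s5 : bOfA a 5 = hForm a 13 := by simp [bOfA, hForm, hList]
  have s6 : bOfA a 6 = hForm a 17 := by simp [bOfA, hForm, hList]; ring
  have s7 : bOfA a 7 = hForm a 24 := by simp [bOfA, hForm, hList]
  simp only [rhoOf, rhoH, Epairs, List.map, List.prod_cons, List.prod_nil, e12, e13, e14, e15, e23, e24, e25, e26, e34,
    e36, e37, e47, e56, e57, e67]
  rw [s1, s4, s5, s6, s7]

/-- The region of the conjecture is `S₇`-invariant. -/
theorem region_permLower (σ : Equiv.Perm (Fin 7)) {b : ℕ → ℤ} (h : ∀ i ∈ Icc 1 7, 0 ≤ b i ∧ 2 * b i ≤ b 0 + 1) :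
    ∀ i ∈ Icc 1 7, 0 ≤ permLower σ b i ∧ 2 * permLower σ b i ≤ permLower σ b 0 + 1 := by
  intro i hi
  rw [mem_Icc] at hi
  obtain ⟨k, rfl⟩ : ∃ k : Fin 7, i = k.val + 1 := ⟨⟨i - 1, by omega⟩, by simp only; omega⟩
  rw [permLower_apply_succ, permLower_zero]
  exact h _ (mem_Icc.2 ⟨by omega, by omega⟩)

/-- The minor `M₃` is `S₇`-invariant (its data `pfData`, `U`, `W`, `b₀` are). -/
theorem quadM3_permLower (σ : Equiv.Perm (Fin 7)) (b : ℕ → ℤ) : quadM3 (permLower σ b) = quadM3 b := by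
  unfold quadM3
  rw [pfData_permLower, coeffU_permLower, coeffW_permLower, permLower_zero]

/-- A vector equals `σ • b(a)` as soon as its slots `1..7` are the permuted slots and slot `0` agrees (slots `≥ 8` of
`bOfA` are `0`). -/
theorem bOfA_eq_permLower {a a' : Fin 8 → ℤ} {σ : Equiv.Perm (Fin 7)} (h0 : bOfA a' 0 = bOfA a 0)
    (h : ∀ k : Fin 7, bOfA a' (k.val + 1) = bOfA a ((σ k).val + 1)) : bOfA a' = permLower σ (bOfA a) := by
  funext i
  by_cases hi : 1 ≤ i ∧ i ≤ 7
  · obtain ⟨k, rfl⟩ : ∃ k : Fin 7, i = k.val + 1 := ⟨⟨i - 1, by omega⟩, by simp only; omega⟩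
    rw [permLower_apply_succ, h]
  · rw [permLower_apply_of_not _ _ hi]
    obtain rfl | hi8 : i = 0 ∨ 8 ≤ i := by omega
    · exact h0
    · obtain ⟨k, rfl⟩ : ∃ k, i = k + 8 := ⟨i - 8, by omega⟩
      rfl

/-! ## 2. The generic pull-back along a generator -/

/-- **TRANSPORT OF THE CONCLUSION.**  Let `g` act on `b(a)` by the slot permutation `σ` and let `ρ` carry the factorial gauge.
For convergent `a` in the region with `d ≥ 0`, convergent `g a` and (27) at `g` (`I(g a)/Π_F(g a) = I(a)/Π_F(a)`), the conclusion
at `(g a, m+1)` gives the conclusion at `(a, σ(m)+1)`.  (`Q` follows the gauge by the tree's theorem `qPart_holds` and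
`quadM3_permLower`; `U, V` are `S₇`-invariant; the rational `P` is rescaled by `Π_F(a)/Π_F(g a)`.) -/
theorem phatConclusion_transport {g : (Fin 8 → ℤ) → Fin 8 → ℤ} {σ : Equiv.Perm (Fin 7)}
    (hb : ∀ a, bOfA (g a) = permLower σ (bOfA a)) (hρ : ∀ a, rhoOf (g a) * prodFQ a = rhoOf a * prodFQ (g a))
    {a : Fin 8 → ℤ} (ha : Converges a) (hga : Converges (g a)) (hI : normalisedIntegral' (g a) = normalisedIntegral' a)
    (hreg : ∀ i ∈ Icc 1 7, 0 ≤ bOfA a i ∧ 2 * bOfA a i ≤ bOfA a 0 + 1) (hd : 0 ≤ dOf (bOfA a)) (m : Fin 7)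
    (hP : PhatConclusion (g a) (m.val + 1)) : PhatConclusion a ((σ m).val + 1) := by
  have hreg' : ∀ i ∈ Icc 1 7, 0 ≤ bOfA (g a) i ∧ 2 * bOfA (g a) i ≤ bOfA (g a) 0 + 1 := by
    rw [hb]; exact region_permLower σ hreg
  have hd' : 0 ≤ dOf (bOfA (g a)) := by rw [hb, dOf_permLower]; exact hd
  have hQ : ((QOf a : ℚ) : ℝ) = ((rhoOf a * quadM3 (bOfA a) : ℚ) : ℝ) := by rw [qPart_holds a ha hreg hd]
  have hQ' : ((QOf (g a) : ℚ) : ℝ) = ((rhoOf (g a) * quadM3 (bOfA a) : ℚ) : ℝ) := by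
    rw [qPart_holds (g a) hga hreg' hd', hb, quadM3_permLower]
  push_cast at hQ hQ'
  have hρ' : ((rhoOf (g a) * prodFQ a : ℚ) : ℝ) = ((rhoOf a * prodFQ (g a) : ℚ) : ℝ) := by rw [hρ a]
  push_cast at hρ'
  have hFa : (0 : ℝ) < prodFQ a := by exact_mod_cast prodFQ_pos a
  have hFga : (0 : ℝ) < prodFQ (g a) := by exact_mod_cast prodFQ_pos (g a)
  rw [normalisedIntegral'_eq, normalisedIntegral'_eq, div_eq_div_iff hFga.ne' hFa.ne'] at hI
  obtain ⟨P, hP⟩ := hP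
  rw [update_eq_shift, hb, shift_permLower, coeffU_permLower, coeffV_permLower, coeffU_permLower,
    coeffV_permLower] at hP
  set K := coeffU (bOfA a) * coeffV (shift (bOfA a) ((σ m).val + 1)) -
    coeffU (shift (bOfA a) ((σ m).val + 1)) * coeffV (bOfA a) with hK
  refine ⟨P * prodFQ a / prodFQ (g a), ?_⟩
  rw [update_eq_shift, ← hK]
  have eI : cellularIntegral a = cellularIntegral (g a) * (prodFQ a : ℝ) / (prodFQ (g a) : ℝ) := by
    rw [eq_div_iff hFga.ne']
    linarith
  rw [eI, hP, div_eq_iff hFga.ne']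
  push_cast
  rw [hQ, hQ']
  field_simp
  linear_combination ((quadM3 (bOfA a) : ℝ) * (2 * zetaValue 5 + 4 * zetaValue 3 * zetaValue 2) -
    4 * (K : ℝ) * zetaValue 2) * hρ'

/-- The mirror node `phatPartResidueLDMirror` discharges `PhatConclusion` under its ten hypotheses (unfolding). -/
theorem phatConclusion_of_LDMirror (h : phatPartResidueLDMirror) {a : Fin 8 → ℤ} {j : ℕ} (hj : j ∈ Icc 1 7)
    (hconv : Converges a) (hreg : ∀ i ∈ Icc 1 7, 0 ≤ bOfA a i ∧ 2 * bOfA a i ≤ bOfA a 0 + 1) (hd : 0 ≤ dOf (bOfA a))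
    (hj' : 2 * (bOfA a j + 1) ≤ bOfA a 0 + 1) (hbox : ∀ i ∈ Icc 1 7, 2 * bOfA a i ≤ bOfA a 0)
    (hp : ∀ i, 0 ≤ pOf a i) (hq : ∀ i, 0 ≤ qOf a i) (hres : pOf a 2 + qOf a 1 ≤ pOf a 3)
    (hcl : bOfA a 0 - bOfA a 4 - bOfA a 3 ≤ dOf (bOfA a) + max 0 (max (bOfA a 5 - bOfA a 4) (bOfA a 5 - bOfA a 3))) :
    PhatConclusion a j :=
  h a j hj hconv hreg hd hj' hbox hp hq hres hcl

/-! ## 3. The five generators: slot transpositions, the gauge of `ρ`, and the pull-backs -/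

/-- `b(p₀₁ a) = (3 4) • b(a)`. -/
theorem bOfA_genP01 (a : Fin 8 → ℤ) : bOfA (genP01 a) = permLower (Equiv.swap (2 : Fin 7) 3) (bOfA a) :=
  bOfA_eq_permLower (by simp [bOfA, genP01]; ring) (fun k => by
    fin_cases k <;> simp [bOfA, genP01, Equiv.swap_apply_def] <;> ring)

/-- `b(p₁₂ a) = (3 5) • b(a)`. -/
theorem bOfA_genP12 (a : Fin 8 → ℤ) : bOfA (genP12 a) = permLower (Equiv.swap (2 : Fin 7) 4) (bOfA a) :=
  bOfA_eq_permLower (by simp [bOfA, genP12]; ring) (fun k => by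
    fin_cases k <;> simp [bOfA, genP12, Equiv.swap_apply_def] <;> ring)

/-- `b(h a) = (3 6) • b(a)`. -/
theorem bOfA_genH (a : Fin 8 → ℤ) : bOfA (genH a) = permLower (Equiv.swap (2 : Fin 7) 5) (bOfA a) :=
  bOfA_eq_permLower (by simp [bOfA, genH]; ring) (fun k => by
    fin_cases k <;> simp [bOfA, genH, Equiv.swap_apply_def] <;> ring)

/-- `b(h′ a) = (4 6) • b(a)`. -/
theorem bOfA_genHp (a : Fin 8 → ℤ) : bOfA (genH' a) = permLower (Equiv.swap (3 : Fin 7) 5) (bOfA a) :=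
  bOfA_eq_permLower (by simp [bOfA, genH']) (fun k => by
    fin_cases k <;> simp [bOfA, genH', Equiv.swap_apply_def] <;> ring)

/-- Gauge of `ρ` under `i₁` (here the gauge is trivial, cf. `rhoOf_genI1`, `prodF_genI1`). -/
theorem rho_gauge_genI1 (a : Fin 8 → ℤ) : rhoOf (genI1 a) * prodFQ a = rhoOf a * prodFQ (genI1 a) := by
  obtain ⟨h1, h2, h3, h4, h5, h6, h7, -, h9, h10, h11, h12, h13, h14, h15, h16, h17, h18, -, h20, -, -, h23, h24, -, -, h27,
    h28⟩ := hForm_genI1 a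
  have hs := sum_range7_permLower slotPermI1 (bOfA a) id
  simp only [id] at hs
  rw [rhoOf_eq_rhoH, rhoOf_eq_rhoH]
  simp only [rhoH, prodFQ, Fset, List.map, List.prod_cons, List.prod_nil, bOfA_genI1, dOf_permLower, hs, h1, h2, h3, h4,
    h5, h6, h7, h9, h10, h11, h12, h13, h14, h15, h16, h17, h18, h20, h23, h24, h27, h28]
  field_simp

/-- **Gauge of `ρ` under `p₀₁`**: `ρ(p₀₁ a)·Π_F(a) = ρ(a)·Π_F(p₀₁ a)` (formal identity in the 28 forms). -/
theorem rho_gauge_genP01 (a : Fin 8 → ℤ) : rhoOf (genP01 a) * prodFQ a = rhoOf a * prodFQ (genP01 a) := by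
  obtain ⟨h1, h2, h3, h4, h5, h6, h7, -, h9, h10, h11, h12, h13, h14, h15, h16, h17, h18, -, h20, -, -, h23, h24, -, -, h27,
    h28⟩ := hForm_genP01 a
  have hs := sum_range7_permLower (Equiv.swap (2 : Fin 7) 3) (bOfA a) id
  simp only [id] at hs
  rw [rhoOf_eq_rhoH, rhoOf_eq_rhoH]
  simp only [rhoH, prodFQ, Fset, List.map, List.prod_cons, List.prod_nil, bOfA_genP01, dOf_permLower, hs, h1, h2, h3, h4,
    h5, h6, h7, h9, h10, h11, h12, h13, h14, h15, h16, h17, h18, h20, h23, h24, h27, h28]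
  field_simp

/-- **Gauge of `ρ` under `p₁₂`.** -/
theorem rho_gauge_genP12 (a : Fin 8 → ℤ) : rhoOf (genP12 a) * prodFQ a = rhoOf a * prodFQ (genP12 a) := by
  obtain ⟨h1, h2, h3, h4, h5, h6, h7, -, h9, h10, h11, h12, h13, h14, h15, h16, h17, h18, -, h20, -, -, h23, h24, -, -, h27,
    h28⟩ := hForm_genP12 a
  have hs := sum_range7_permLower (Equiv.swap (2 : Fin 7) 4) (bOfA a) id
  simp only [id] at hs
  rw [rhoOf_eq_rhoH, rhoOf_eq_rhoH]
  simp only [rhoH, prodFQ, Fset, List.map, List.prod_cons, List.prod_nil, bOfA_genP12, dOf_permLower, hs, h1, h2, h3, h4,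
    h5, h6, h7, h9, h10, h11, h12, h13, h14, h15, h16, h17, h18, h20, h23, h24, h27, h28]
  field_simp

/-- **Gauge of `ρ` under `h`.** -/
theorem rho_gauge_genH (a : Fin 8 → ℤ) : rhoOf (genH a) * prodFQ a = rhoOf a * prodFQ (genH a) := by
  obtain ⟨h1, h2, h3, h4, h5, h6, h7, -, h9, h10, h11, h12, h13, h14, h15, h16, h17, h18, -, h20, -, -, h23, h24, -, -, h27,
    h28⟩ := hForm_genH a
  have hs := sum_range7_permLower (Equiv.swap (2 : Fin 7) 5) (bOfA a) id
  simp only [id] at hs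
  rw [rhoOf_eq_rhoH, rhoOf_eq_rhoH]
  simp only [rhoH, prodFQ, Fset, List.map, List.prod_cons, List.prod_nil, bOfA_genH, dOf_permLower, hs, h1, h2, h3, h4,
    h5, h6, h7, h9, h10, h11, h12, h13, h14, h15, h16, h17, h18, h20, h23, h24, h27, h28]
  field_simp

/-- **Gauge of `ρ` under `h′`.** -/
theorem rho_gauge_genHp (a : Fin 8 → ℤ) : rhoOf (genH' a) * prodFQ a = rhoOf a * prodFQ (genH' a) := by
  obtain ⟨h1, h2, h3, h4, h5, h6, h7, -, h9, h10, h11, h12, h13, h14, h15, h16, h17, h18, -, h20, -, -, h23, h24, -, -, h27,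
    h28⟩ := hForm_genHp a
  have hs := sum_range7_permLower (Equiv.swap (3 : Fin 7) 5) (bOfA a) id
  simp only [id] at hs
  rw [rhoOf_eq_rhoH, rhoOf_eq_rhoH]
  simp only [rhoH, prodFQ, Fset, List.map, List.prod_cons, List.prod_nil, bOfA_genHp, dOf_permLower, hs, h1, h2, h3, h4,
    h5, h6, h7, h9, h10, h11, h12, h13, h14, h15, h16, h17, h18, h20, h23, h24, h27, h28]
  field_simp

/-- **Pull-back along `i₁`** (from (27) at `i₁`): conclusion at `(i₁ a, m+1)` ⇒ conclusion at `(a, σ(m)+1)`, `σ = (1 4)(2 3)(5 7)`. -/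
theorem phatConclusion_genI1 (hInv : invariance_of_converges') {a : Fin 8 → ℤ} (ha : Converges a)
    (hga : Converges (genI1 a)) (hreg : ∀ i ∈ Icc 1 7, 0 ≤ bOfA a i ∧ 2 * bOfA a i ≤ bOfA a 0 + 1) (hd : 0 ≤ dOf (bOfA a))
    (m : Fin 7) (hP : PhatConclusion (genI1 a) (m.val + 1)) : PhatConclusion a ((slotPermI1 m).val + 1) :=
  phatConclusion_transport bOfA_genI1 rho_gauge_genI1 ha hga ((hInv a ha).1 hga) hreg hd m hP

/-- **Pull-back along `p₀₁`** (from (27) at `p₀₁`): conclusion at `(p₀₁ a, m+1)` ⇒ conclusion at `(a, σ(m)+1)`, `σ = (3 4)`. -/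
theorem phatConclusion_genP01 (hInv : invariance_of_converges') {a : Fin 8 → ℤ} (ha : Converges a)
    (hga : Converges (genP01 a)) (hreg : ∀ i ∈ Icc 1 7, 0 ≤ bOfA a i ∧ 2 * bOfA a i ≤ bOfA a 0 + 1) (hd : 0 ≤ dOf (bOfA a))
    (m : Fin 7) (hP : PhatConclusion (genP01 a) (m.val + 1)) : PhatConclusion a ((Equiv.swap (2 : Fin 7) 3 m).val + 1) :=
  phatConclusion_transport bOfA_genP01 rho_gauge_genP01 ha hga ((hInv a ha).2.1 hga) hreg hd m hP

/-- **Pull-back along `p₁₂`** (from (27) at `p₁₂`), `σ = (3 5)`. -/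
theorem phatConclusion_genP12 (hInv : invariance_of_converges') {a : Fin 8 → ℤ} (ha : Converges a)
    (hga : Converges (genP12 a)) (hreg : ∀ i ∈ Icc 1 7, 0 ≤ bOfA a i ∧ 2 * bOfA a i ≤ bOfA a 0 + 1) (hd : 0 ≤ dOf (bOfA a))
    (m : Fin 7) (hP : PhatConclusion (genP12 a) (m.val + 1)) : PhatConclusion a ((Equiv.swap (2 : Fin 7) 4 m).val + 1) :=
  phatConclusion_transport bOfA_genP12 rho_gauge_genP12 ha hga ((hInv a ha).2.2.1 hga) hreg hd m hP

/-- **Pull-back along `h`** (from (27) at `h`), `σ = (3 6)`. -/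
theorem phatConclusion_genH (hInv : invariance_of_converges') {a : Fin 8 → ℤ} (ha : Converges a)
    (hga : Converges (genH a)) (hreg : ∀ i ∈ Icc 1 7, 0 ≤ bOfA a i ∧ 2 * bOfA a i ≤ bOfA a 0 + 1) (hd : 0 ≤ dOf (bOfA a))
    (m : Fin 7) (hP : PhatConclusion (genH a) (m.val + 1)) : PhatConclusion a ((Equiv.swap (2 : Fin 7) 5 m).val + 1) :=
  phatConclusion_transport bOfA_genH rho_gauge_genH ha hga ((hInv a ha).2.2.2.1 hga) hreg hd m hP

/-- **Pull-back along `h′`** (from (27) at `h′`), `σ = (4 6)`. -/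
theorem phatConclusion_genHp (hInv : invariance_of_converges') {a : Fin 8 → ℤ} (ha : Converges a)
    (hga : Converges (genH' a)) (hreg : ∀ i ∈ Icc 1 7, 0 ≤ bOfA a i ∧ 2 * bOfA a i ≤ bOfA a 0 + 1) (hd : 0 ≤ dOf (bOfA a))
    (m : Fin 7) (hP : PhatConclusion (genH' a) (m.val + 1)) : PhatConclusion a ((Equiv.swap (3 : Fin 7) 5 m).val + 1) :=
  phatConclusion_transport bOfA_genHp rho_gauge_genHp ha hga ((hInv a ha).2.2.2.2 hga) hreg hd m hP

/-! ## 4. Worked example: a point in neither residue range, reached in one `h′`-step from the mirror node -/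

/-- `a = (1,1,1,1,2,1,2,1)` (`b = (3;1,1,1,0,1,1,0)`, `p₄+q₄−p₃ = 1 = p₂+q₂−p₃`: neither residue range) has
`h′(a) = (1,1,1,1,1,2,3,1)` satisfying all ten hypotheses of the MIRROR node (decided by the kernel); pulling back along `h′`
gives the `P̂`-part at `a` (partner `j = 1`) from the four cited facts. -/
example (h22 : descent22) (hZ : vwp_eq_integral_of_pos) (hBc : baileyTransformClosed) (hInv : invariance_of_converges') :
    PhatConclusion ![1, 1, 1, 1, 2, 1, 2, 1] 1 :=
  phatConclusion_genHp hInv (a := ![1, 1, 1, 1, 2, 1, 2, 1]) (by decide) (by decide) (by decide) (by decide) 0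
    (phatConclusion_of_LDMirror (phatPartLDMirror_of_descent22 h22 hZ hBc hInv) (by decide) (by decide) (by decide)
      (by decide) (by decide) (by decide) (by decide) (by decide) (by decide) (by decide))

end Summit.KontsevichZagierPeriods.Zeta5Search.WedgeDictionary
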